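import Summits.QuantumFields.YangMills.Theses.ConvexGribovBody
import Literature.MathematicalPhysics.QuantumFieldTheory.LatticeGaugeProofs

/-!
# Route `ConvexGribovBody`, crux `CovarianceBound` (stmt-QuantumFields-8780): vocabulary of the line `Sketch`
# (support slope × response window)

Route-posited objects (D-0016 `<Route><Crux>Defs` file) shared by the registered stubs of the skeleton
`Cruxes/CovarianceBound/Lines/Sketch.lean` (lead `prover-line-stmt-QuantumFields-8780-0`) and by the crux file
that composes them. The declarations are VERBATIM those of the registered skeleton (same namespace, so the
registered stub signatures are unchanged). Nothing here is asserted: the data definitions transcribe the `let`s of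
`Summit.QuantumFields.YangMills.Theses.ConvexGribovBody.CovarianceBound` (`froSq` = its `fro`, `coulombF` = its
`coul`, `IsCoulMin` = its minimiser subtype predicate, `modeCov` = its `cov`, `supCov` = its integrand), so that
`covarianceBound_iff` holds by `Iff.rfl`; the remaining definitions are the mid-link cosine/sine Fourier modes
`cosMode`/`sinMode` of the gauge-fixed gluon field `gluon` (with `‖Â_j(p)‖² = ‖Ĉ_j(p)‖² + ‖Ŝ_j(p)‖²`), their sups
over minimisers, the real components `cosComp` entering the Lee–Yang window, the lattice infrared scale
`irScale = √(p̂² + (2π/L)²)`, and `wilson4 r β S = wilsonMeasure (d := 4) (L := 2S+1) r.ρ β` (a named-argument-free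
abbreviation; registered signatures must not contain `:=`).

References: idea card `Cruxes/CovarianceBound/Ideas/support-slope-x-response-window.md`; Zwanziger, Nucl. Phys.
B364 (1991) 127; Zwanziger, Phys. Rev. D 87 (2013) 085039, App. D; Maas–Zwanziger, Phys. Rev. D 89 (2014) 034011.
-/

set_option autoImplicit false

noncomputable section

namespace Summit.QuantumFields.YangMills.Cruxes.CovarianceBound.SupportWindow

open scoped BigOperators Topology Manifold Classical MeasureTheory ProbabilityTheory Matrix InnerProductSpace ComplexConjugate ContinuousMap
open Filter Set Function TopologicalSpace MeasureTheory
open Literature.MathematicalPhysics.QuantumFieldTheory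

variable {G : Type} [Group G] [TopologicalSpace G]

/-- Squared Frobenius norm `Σ_{a,b} |M_{ab}|²` (the crux's `fro`). -/
def froSq {N : ℕ} (M : Matrix (Fin N) (Fin N) ℂ) : ℝ := ∑ a, ∑ b, ‖M a b‖ ^ 2

/-- The slice Coulomb functional `coul(U,h) = -Σ_{e spatial, t = 0} Re tr ρ((U^h)_e)` on the torus
`(2S+1)⁴` (the crux's `coul`, verbatim). -/
def coulombF (r : LatticeRep G) (S : ℕ) (U : GaugeConfig 4 (2 * S + 1) G)
    (h : Site 4 (2 * S + 1) → G) : ℝ :=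
  -∑ e : Edge 4 (2 * S + 1),
    (if e.1 0 = 0 ∧ e.2 ≠ 0 then (r.ρ (gaugeTransform h U e)).trace.re else 0)

/-- `h` is an absolute minimiser of the slice Coulomb functional of `U` (minimal lattice Coulomb
gauge / fundamental modular region; the crux's subtype predicate, verbatim). -/
def IsCoulMin (r : LatticeRep G) (S : ℕ) (U : GaugeConfig 4 (2 * S + 1) G)
    (h : Site 4 (2 * S + 1) → G) : Prop :=
  ∀ h', coulombF r S U h ≤ coulombF r S U h'

/-- The gauge-fixed lattice gluon field `A_j(y) = ½(ρ(V) - ρ(V)ᴴ)`, `V = (U^h)_{((0,y), j+1)}`, on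
the spatial links of the time-zero slice (anti-Hermitian part, trace part included, as in the crux). -/
def gluon (r : LatticeRep G) (S : ℕ) (U : GaugeConfig 4 (2 * S + 1) G)
    (h : Site 4 (2 * S + 1) → G) (y : Fin 3 → ZMod (2 * S + 1)) (j : Fin 3) :
    Matrix (Fin r.N) (Fin r.N) ℂ :=
  (1 / 2 : ℂ) • (r.ρ (gaugeTransform h U (Fin.cons (0 : ZMod (2 * S + 1)) y, j.succ)) -
    (r.ρ (gaugeTransform h U (Fin.cons (0 : ZMod (2 * S + 1)) y, j.succ)))ᴴ)

/-- The equal-time gluon covariance integrand `cov(U,h,p) = L⁻³ Σ_j ‖Σ_y e^{-2πi p·y/L} A_j(y)‖²_F`,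
`L = 2S+1` (the crux's `cov`, verbatim). -/
def modeCov (r : LatticeRep G) (S : ℕ) (U : GaugeConfig 4 (2 * S + 1) G)
    (h : Site 4 (2 * S + 1) → G) (p : Fin 3 → ZMod (2 * S + 1)) : ℝ :=
  (∑ j : Fin 3, froSq (∑ y : Fin 3 → ZMod (2 * S + 1),
    Complex.exp (-(2 * Real.pi * Complex.I *
      (∑ i : Fin 3, ((p i).val : ℂ) * ((y i).val : ℂ)) / (2 * S + 1 : ℂ))) •
      ((1 / 2 : ℂ) • (r.ρ (gaugeTransform h U (Fin.cons (0 : ZMod (2 * S + 1)) y, j.succ)) -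
        (r.ρ (gaugeTransform h U (Fin.cons (0 : ZMod (2 * S + 1)) y, j.succ)))ᴴ)))) /
    ((2 * S + 1 : ℝ) ^ 3)

/-- The crux's integrand: `sup` of `cov(U,·,p)` over the absolute Coulomb minimisers of `U`
(an `iSup` over a nonempty subtype with bounded range, `stub_supMeasurable`). -/
def supCov (r : LatticeRep G) (S : ℕ) (p : Fin 3 → ZMod (2 * S + 1))
    (U : GaugeConfig 4 (2 * S + 1) G) : ℝ :=
  ⨆ h : {h : Site 4 (2 * S + 1) → G // IsCoulMin r S U h}, modeCov r S U h.1 p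

/-- Lattice momentum squared `p̂² = Σ_i 4 sin²(π p_i / L)`, `L = 2S+1`. -/
def latMomSq (S : ℕ) (p : Fin 3 → ZMod (2 * S + 1)) : ℝ :=
  ∑ i : Fin 3, 4 * Real.sin (Real.pi * (p i).val / (2 * S + 1)) ^ 2

/-- The infrared scale `√(p̂² + (2π/L)²)` of the line (support slope and window radius). -/
def irScale (S : ℕ) (p : Fin 3 → ZMod (2 * S + 1)) : ℝ :=
  Real.sqrt (latMomSq S p + (2 * Real.pi / (2 * S + 1)) ^ 2)

/-- Mid-link cosine mode `Ĉ_j(p) = Σ_y cos(2π(p·y + p_j/2)/L) A_j(y)` (real combination of the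
modes at `±p`; the half-link phase makes the full spatial reflection act by `Ĉ ↦ -Ĉ`, `Ŝ ↦ Ŝ`). -/
def cosMode (r : LatticeRep G) (S : ℕ) (p : Fin 3 → ZMod (2 * S + 1)) (j : Fin 3)
    (U : GaugeConfig 4 (2 * S + 1) G) (h : Site 4 (2 * S + 1) → G) :
    Matrix (Fin r.N) (Fin r.N) ℂ :=
  ∑ y : Fin 3 → ZMod (2 * S + 1),
    ((Real.cos (2 * Real.pi * ((∑ i : Fin 3, ((p i).val : ℝ) * ((y i).val : ℝ)) +
      ((p j).val : ℝ) / 2) / (2 * S + 1)) : ℝ) : ℂ) • gluon r S U h y j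

/-- Mid-link sine mode `Ŝ_j(p) = Σ_y sin(2π(p·y + p_j/2)/L) A_j(y)`; `Ŝ_j(0) = 0` and
`‖Â_j(p)‖²_F = ‖Ĉ_j(p)‖²_F + ‖Ŝ_j(p)‖²_F` (`stub_modeReduction`). -/
def sinMode (r : LatticeRep G) (S : ℕ) (p : Fin 3 → ZMod (2 * S + 1)) (j : Fin 3)
    (U : GaugeConfig 4 (2 * S + 1) G) (h : Site 4 (2 * S + 1) → G) :
    Matrix (Fin r.N) (Fin r.N) ℂ :=
  ∑ y : Fin 3 → ZMod (2 * S + 1),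
    ((Real.sin (2 * Real.pi * ((∑ i : Fin 3, ((p i).val : ℝ) * ((y i).val : ℝ)) +
      ((p j).val : ℝ) / 2) / (2 * S + 1)) : ℝ) : ℂ) • gluon r S U h y j

/-- `sup` over the minimisers of `‖Ĉ_j(p)‖²_F`. -/
def supCosSq (r : LatticeRep G) (S : ℕ) (p : Fin 3 → ZMod (2 * S + 1)) (j : Fin 3)
    (U : GaugeConfig 4 (2 * S + 1) G) : ℝ :=
  ⨆ h : {h : Site 4 (2 * S + 1) → G // IsCoulMin r S U h}, froSq (cosMode r S p j U h.1)

/-- `sup` over the minimisers of `‖Ŝ_j(p)‖²_F`. -/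
def supSinSq (r : LatticeRep G) (S : ℕ) (p : Fin 3 → ZMod (2 * S + 1)) (j : Fin 3)
    (U : GaugeConfig 4 (2 * S + 1) G) : ℝ :=
  ⨆ h : {h : Site 4 (2 * S + 1) → G // IsCoulMin r S U h}, froSq (sinMode r S p j U h.1)

/-- The real components `X = Re (Ĉ_j(p))_{ab}` (`q = true`) / `Im (Ĉ_j(p))_{ab}` (`q = false`) of the
cosine mode in the gauge `sel U` — the bounded real observables the Lee–Yang window is about. -/
def cosComp (r : LatticeRep G) (S : ℕ) (p : Fin 3 → ZMod (2 * S + 1)) (j : Fin 3)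
    (a b : Fin r.N) (q : Bool)
    (sel : GaugeConfig 4 (2 * S + 1) G → (Site 4 (2 * S + 1) → G))
    (U : GaugeConfig 4 (2 * S + 1) G) : ℝ :=
  bif q then (cosMode r S p j U (sel U) a b).re else (cosMode r S p j U (sel U) a b).im

/-- Wilson's probability measure on the torus `(2S+1)⁴` in the representation `r` at coupling `β`:
`wilsonMeasure (d := 4) (L := 2S+1) r.ρ β` without named arguments (registered stub signatures must not
contain `:=`). -/
def wilson4 [IsTopologicalGroup G] [CompactSpace G] [MeasurableSpace G] [BorelSpace G]
    (r : LatticeRep G) (β : ℝ) (S : ℕ) : Measure (GaugeConfig 4 (2 * S + 1) G) :=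
  wilsonMeasure (d := 4) (L := 2 * S + 1) r.ρ β

/-- `wilson4` is a probability measure (`ρ` continuous). -/
instance isProbabilityMeasure_wilson4 [IsTopologicalGroup G] [CompactSpace G] [MeasurableSpace G]
    [BorelSpace G] (r : LatticeRep G) (β : ℝ) (S : ℕ) : IsProbabilityMeasure (wilson4 r β S) :=
  isProbabilityMeasure_wilsonMeasure r.ρ r.continuous β

/-- Bridge to the inline route text: the crux IS the statement over this vocabulary (`Iff.rfl`). -/
theorem covarianceBound_iff :
    Summit.QuantumFields.YangMills.Theses.ConvexGribovBody.CovarianceBound ↔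
      ∀ (G : Type) [Group G] [TopologicalSpace G] [IsTopologicalGroup G] [CompactSpace G]
        [MeasurableSpace G] [BorelSpace G], IsCompactSimpleLieGroup G →
        ∀ r : LatticeRep G, ∃ β₀ : ℝ, ∀ β : ℝ, β₀ ≤ β → ∃ D : ℝ, 0 < D ∧ ∃ S₀ : ℕ, ∀ S : ℕ,
          S₀ ≤ S → ∀ p : Fin 3 → ZMod (2 * S + 1),
            ∫ U, supCov r S p U ∂(wilsonMeasure (d := 4) (L := 2 * S + 1) r.ρ β) ≤ D :=
  Iff.rfl

/-- `irScale > 0`: the floor `(2π/L)²` is positive. -/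
theorem irScale_pos (S : ℕ) (p : Fin 3 → ZMod (2 * S + 1)) : 0 < irScale S p := by
  unfold irScale
  apply Real.sqrt_pos.2
  have h1 : 0 ≤ latMomSq S p := by
    unfold latMomSq
    exact Finset.sum_nonneg fun i _ => by positivity
  have h2 : 0 < (2 * Real.pi / (2 * S + 1)) ^ 2 := by positivity
  linarith

/-- `irScale² = p̂² + (2π/L)²`. -/
theorem irScale_sq (S : ℕ) (p : Fin 3 → ZMod (2 * S + 1)) :
    irScale S p ^ 2 = latMomSq S p + (2 * Real.pi / (2 * S + 1)) ^ 2 := by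
  unfold irScale
  rw [Real.sq_sqrt]
  have h1 : 0 ≤ latMomSq S p := by
    unfold latMomSq
    exact Finset.sum_nonneg fun i _ => by positivity
  positivity

end Summit.QuantumFields.YangMills.Cruxes.CovarianceBound.SupportWindow

end
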